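import Literature.Computability.Cryptography.HallgrenClassGroupQuantumEstimates
import HarnessLib

/-!
# Hallgren 2005 / class numbers under GRH — programming step P9: the subgroup-order algorithm on
# natural residues (`subgroupOrderPure`) and its agreement with `subgroupOrderNat`

Topic `Literature/Computability/Cryptography`; proof companion of `HallgrenClassGroup.lean`
(named fact `Hallgren2005_classNumber_qsolvable_of_GRH`). Definitions and theorems; no named fact.
`SubgroupOrder.subgroupOrder` (`HallgrenClassGroupSubgroupOrder.lean`) computes `|⟨rows⟩|` in
`(ℤ/N)^k` by Howell/Bezout elimination on vectors `Fin k → ZMod N`; the `FP` machine of the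
post-processor works on lists of natural residues. This file writes the SAME algorithm on
`List ℕ` rows with coordinates `mod N` — `zmulK`, `vaddK`, `bezoutPairN`, `elimFoldN`,
`ordN a = N / gcd(N, a)` (`ZMod.addOrderOf_coe`), `ordVecN` (the order of a vector is the lcm of the
orders of its coordinates, `addOrderOf_pi_eq`), `complementRowN`, **`subgroupOrderPure`** — and proves
**`subgroupOrderNatL_eq_pure : subgroupOrderNat N k (rows as functions) = subgroupOrderPure N k rows`**
by simulation (`toV`).

## References

* K. K. H. Cheung, M. Mosca, *Decomposing finite abelian groups*, QIC 1 (2001), §3 [CheungMosca2001].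
* A. Storjohann, T. Mulders, *Fast algorithms for linear algebra modulo N*, ESA 1998 [folklore].
-/

noncomputable section

namespace Literature.Computability.Cryptography.Hallgren2005

namespace Howell

open SubgroupOrder

/-! ### Vectors of residues as lists -/

/-- The vector of a list of residues. [folklore] -/
def toV (N n : ℕ) (r : List ℕ) : Fin n → ZMod N := fun j => ((r.getD j 0 : ℕ) : ZMod N)

/-- `c • v mod N`, on `n` coordinates. [folklore] -/
def zmulK (N n : ℕ) (c : ℤ) (v : List ℕ) : List ℕ := (List.range n).map fun j => ((c * (v.getD j 0 : ℕ)) % (N : ℤ)).toNat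

/-- `v + w mod N`, on `n` coordinates. [folklore] -/
def vaddK (N n : ℕ) (v w : List ℕ) : List ℕ := (List.range n).map fun j => (v.getD j 0 + w.getD j 0) % N

/-- A list is an `(N, n)`-row: length `n`, entries `< N`. [folklore] -/
def IsRow (N n : ℕ) (v : List ℕ) : Prop := v.length = n ∧ ∀ x ∈ v, x < N

variable {N : ℕ} [NeZero N] {n : ℕ}

/-- `getD` of a mapped range. [folklore] -/
theorem getD_map_range {f : ℕ → ℕ} {j : ℕ} (hj : j < n) : ((List.range n).map f).getD j 0 = f j := by
  rw [List.getD_eq_getElem?_getD, List.getElem?_map, List.getElem?_range hj]; rfl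

/-- `zmulK` is a row. [folklore] -/
theorem isRow_zmulK (c : ℤ) (v : List ℕ) : IsRow N n (zmulK N n c v) := by
  refine ⟨by simp [zmulK], fun x hx => ?_⟩
  simp only [zmulK, List.mem_map, List.mem_range] at hx
  obtain ⟨j, -, rfl⟩ := hx
  have hN : (0 : ℤ) < N := by exact_mod_cast Nat.pos_of_ne_zero (NeZero.ne N)
  have h1 := Int.emod_nonneg (c * (v.getD j 0 : ℕ)) hN.ne'
  have h2 := Int.emod_lt_of_pos (c * (v.getD j 0 : ℕ)) hN
  omega

/-- `vaddK` is a row. [folklore] -/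
theorem isRow_vaddK (v w : List ℕ) : IsRow N n (vaddK N n v w) := by
  refine ⟨by simp [vaddK], fun x hx => ?_⟩
  simp only [vaddK, List.mem_map, List.mem_range] at hx
  obtain ⟨j, -, rfl⟩ := hx
  exact Nat.mod_lt _ (Nat.pos_of_ne_zero (NeZero.ne N))

/-- `toV` of `zmulK`. [folklore] -/
theorem toV_zmulK (c : ℤ) (v : List ℕ) : toV N n (zmulK N n c v) = c • toV N n v := by
  funext j
  rw [toV, zmulK, getD_map_range j.isLt, Pi.smul_apply, toV, zsmul_eq_mul]
  have hN : (0 : ℤ) < N := by exact_mod_cast Nat.pos_of_ne_zero (NeZero.ne N)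
  have h1 := Int.emod_nonneg (c * (v.getD j 0 : ℕ)) hN.ne'
  have : (((c * (v.getD j 0 : ℕ)) % (N : ℤ)).toNat : ZMod N) = ((c * (v.getD j 0 : ℕ) : ℤ) : ZMod N) := by
    rw [← Int.cast_natCast, Int.toNat_of_nonneg h1, ZMod.intCast_mod]
  rw [this]; push_cast; ring

omit [NeZero N] in
/-- `toV` of `vaddK`. [folklore] -/
theorem toV_vaddK (v w : List ℕ) : toV N n (vaddK N n v w) = toV N n v + toV N n w := by
  funext j
  rw [toV, vaddK, getD_map_range j.isLt, Pi.add_apply, toV, toV, ZMod.natCast_mod]; push_cast; ring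

/-- The first coordinate of a row, as a value. [folklore] -/
theorem val_toV_zero {v : List ℕ} (hv : IsRow N (n + 1) v) : (toV N (n + 1) v 0).val = v.getD 0 0 := by
  rw [toV, Fin.val_zero, ZMod.val_natCast, Nat.mod_eq_of_lt]
  rw [List.getD_eq_getElem?_getD]
  cases hv0 : v[0]? with
  | none => exact Nat.pos_of_ne_zero (NeZero.ne N)
  | some x => exact hv.2 x (List.mem_of_getElem? hv0)

/-! ### The Bezout transform and the elimination pass -/

/-- The Bezout transform on residue rows. [cite: CheungMosca2001, §3] -/
def bezoutPairN (N n : ℕ) (p r : List ℕ) : List ℕ × List ℕ :=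
  let a := p.getD 0 0
  let b := r.getD 0 0
  (vaddK N n (zmulK N n (Nat.gcdA a b) p) (zmulK N n (Nat.gcdB a b) r),
    vaddK N n (zmulK N n ((b / Nat.gcd a b : ℕ) : ℤ) p) (zmulK N n (-((a / Nat.gcd a b : ℕ) : ℤ)) r))

/-- `bezoutPairN` simulates `bezoutPair`. [folklore] -/
theorem toV_bezoutPairN {p r : List ℕ} (hp : IsRow N (n + 1) p) (hr : IsRow N (n + 1) r) :
    toV N (n + 1) (bezoutPairN N (n + 1) p r).1 = (bezoutPair (toV N (n + 1) p) (toV N (n + 1) r)).1 ∧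
      toV N (n + 1) (bezoutPairN N (n + 1) p r).2 = (bezoutPair (toV N (n + 1) p) (toV N (n + 1) r)).2 := by
  simp only [bezoutPairN, bezoutPair, toV_vaddK, toV_zmulK, val_toV_zero hp, val_toV_zero hr, neg_smul, sub_eq_add_neg,
    and_self]

/-- Both Bezout rows are rows. [folklore] -/
theorem isRow_bezoutPairN (p r : List ℕ) :
    IsRow N n (bezoutPairN N n p r).1 ∧ IsRow N n (bezoutPairN N n p r).2 :=
  ⟨isRow_vaddK _ _, isRow_vaddK _ _⟩

/-- The elimination pass on residue rows. [cite: CheungMosca2001, §3] -/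
def elimFoldN (N n : ℕ) : Option (List ℕ) → List (List ℕ) → List (List ℕ) → Option (List ℕ) × List (List ℕ)
  | p?, rest, [] => (p?, rest)
  | none, rest, r :: rs => if r.getD 0 0 = 0 then elimFoldN N n none (r :: rest) rs else elimFoldN N n (some r) rest rs
  | some p, rest, r :: rs => elimFoldN N n (some (bezoutPairN N n p r).1) ((bezoutPairN N n p r).2 :: rest) rs

/-- First coordinate zero, on rows. [folklore] -/
theorem toV_zero_eq_zero_iff {v : List ℕ} (hv : IsRow N (n + 1) v) : toV N (n + 1) v 0 = 0 ↔ v.getD 0 0 = 0 := by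
  rw [← ZMod.val_eq_zero, val_toV_zero hv]

/-- **`elimFoldN` simulates `elimFold`** and keeps rows. [folklore] -/
theorem elimFoldN_spec : ∀ (rs : List (List ℕ)) (p? : Option (List ℕ)) (rest : List (List ℕ)),
    (∀ v ∈ rs, IsRow N (n + 1) v) → (∀ p, p? = some p → IsRow N (n + 1) p) → (∀ v ∈ rest, IsRow N (n + 1) v) →
      (elimFoldN N (n + 1) p? rest rs).1.map (toV N (n + 1)) =
          (elimFold (p?.map (toV N (n + 1))) (rest.map (toV N (n + 1))) (rs.map (toV N (n + 1)))).1 ∧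
        (elimFoldN N (n + 1) p? rest rs).2.map (toV N (n + 1)) =
          (elimFold (p?.map (toV N (n + 1))) (rest.map (toV N (n + 1))) (rs.map (toV N (n + 1)))).2 ∧
        (∀ p, (elimFoldN N (n + 1) p? rest rs).1 = some p → IsRow N (n + 1) p) ∧
        (∀ v ∈ (elimFoldN N (n + 1) p? rest rs).2, IsRow N (n + 1) v)
  | [], p?, rest, _, hp, hrest => by
    cases p? <;> exact ⟨rfl, rfl, hp, hrest⟩
  | r :: rs, none, rest, hrs, _, hrest => by
    have hr : IsRow N (n + 1) r := hrs r (by simp)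
    have hrs' : ∀ v ∈ rs, IsRow N (n + 1) v := fun v hv => hrs v (by simp [hv])
    rw [elimFoldN, List.map_cons, Option.map_none, elimFold]
    by_cases h0 : r.getD 0 0 = 0
    · rw [if_pos h0, if_pos ((toV_zero_eq_zero_iff hr).2 h0)]
      have ih := elimFoldN_spec rs none (r :: rest) hrs' (fun p h => by cases h) (by
        intro v hv; rcases List.mem_cons.1 hv with rfl | hv; exacts [hr, hrest v hv])
      simpa using ih
    · rw [if_neg h0, if_neg (fun h => h0 ((toV_zero_eq_zero_iff hr).1 h))]
      have ih := elimFoldN_spec rs (some r) rest hrs' (fun p h => by cases h; exact hr) hrest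
      simpa using ih
  | r :: rs, some p, rest, hrs, hp, hrest => by
    have hr : IsRow N (n + 1) r := hrs r (by simp)
    have hp' : IsRow N (n + 1) p := hp p rfl
    have hrs' : ∀ v ∈ rs, IsRow N (n + 1) v := fun v hv => hrs v (by simp [hv])
    rw [elimFoldN, List.map_cons, Option.map_some, elimFold]
    obtain ⟨b1, b2⟩ := toV_bezoutPairN hp' hr
    have ih := elimFoldN_spec rs (some (bezoutPairN N (n + 1) p r).1) ((bezoutPairN N (n + 1) p r).2 :: rest) hrs'
      (fun q h => by cases h; exact (isRow_bezoutPairN p r).1) (by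
        intro v hv; rcases List.mem_cons.1 hv with rfl | hv; exacts [(isRow_bezoutPairN p r).2, hrest v hv])
    rw [Option.map_some, List.map_cons, b1, b2] at ih
    exact ih

/-! ### Orders -/

/-- The order of a residue: `N / gcd(N, a)`. [folklore] -/
def ordN (N a : ℕ) : ℕ := N / Nat.gcd N a

/-- `ordN` is the additive order in `ℤ/N`. [folklore] -/
theorem ordN_eq (a : ℕ) : ordN N a = addOrderOf (a : ZMod N) := (ZMod.addOrderOf_coe a (NeZero.ne N)).symm

/-- The lcm of a list. [folklore] -/
def listLcm (L : List ℕ) : ℕ := L.foldr Nat.lcm 1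

omit [NeZero N] in
/-- `listLcm L ∣ m` iff every member divides `m`. [folklore] -/
theorem listLcm_dvd_iff {L : List ℕ} {m : ℕ} : listLcm L ∣ m ↔ ∀ x ∈ L, x ∣ m := by
  induction L with
  | nil => simp [listLcm]
  | cons a L ih => rw [listLcm, List.foldr_cons, ← listLcm, Nat.lcm_dvd_iff, ih]; simp

/-- The order of a residue row: the lcm of the orders of its coordinates. [folklore] -/
def ordVecN (N : ℕ) (v : List ℕ) : ℕ := listLcm (v.map (ordN N))

omit [NeZero N] in
/-- **The order of a vector is the lcm of the orders of its coordinates.** [folklore] -/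
theorem addOrderOf_pi_dvd_iff (v : Fin n → ZMod N) (m : ℕ) : addOrderOf v ∣ m ↔ ∀ j, addOrderOf (v j) ∣ m := by
  simp only [addOrderOf_dvd_iff_nsmul_eq_zero, funext_iff, Pi.smul_apply, Pi.zero_apply]

/-- **`ordVecN` is the additive order of the row.** [folklore] -/
theorem ordVecN_eq {v : List ℕ} (hv : IsRow N n v) : ordVecN N v = addOrderOf (toV N n v) := by
  apply Nat.dvd_antisymm
  · rw [ordVecN, listLcm_dvd_iff]
    intro x hx
    obtain ⟨a, ha, rfl⟩ := List.mem_map.1 hx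
    obtain ⟨j, hj, rfl⟩ := List.getElem_of_mem ha
    have hj' : j < n := hv.1 ▸ hj
    have := (addOrderOf_pi_dvd_iff (toV N n v) _).1 dvd_rfl ⟨j, hj'⟩
    rwa [toV, Fin.val_mk, List.getD_eq_getElem?_getD, List.getElem?_eq_getElem hj, Option.getD_some, ← ordN_eq] at this
  · rw [addOrderOf_pi_dvd_iff]
    intro j
    rw [toV, ← ordN_eq]
    refine (listLcm_dvd_iff.1 dvd_rfl) _ (List.mem_map.2 ⟨v.getD j 0, ?_, rfl⟩)
    rw [List.getD_eq_getElem?_getD, List.getElem?_eq_getElem (hv.1 ▸ j.isLt), Option.getD_some]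
    exact List.getElem_mem _

/-- The complement row `ord(p₀) · p`. [folklore] -/
def complementRowN (N n : ℕ) (p : List ℕ) : List ℕ := zmulK N n (ordN N (p.getD 0 0)) p

/-- `complementRowN` simulates `complementRow`. [folklore] -/
theorem toV_complementRowN {p : List ℕ} (hp : IsRow N (n + 1) p) :
    toV N (n + 1) (complementRowN N (n + 1) p) = complementRow (toV N (n + 1) p) := by
  rw [complementRowN, toV_zmulK, complementRow, ordN_eq, ← val_toV_zero hp, ZMod.natCast_zmod_val, natCast_zsmul]

/-! ### The recursion -/

omit [NeZero N] in
/-- Tails of rows. [folklore] -/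
theorem toV_tail (v : List ℕ) : toV N n v.tail = Fin.tail (toV N (n + 1) v) := by
  funext j
  rw [toV, Fin.tail, toV, Fin.val_succ, List.getD_eq_getElem?_getD, List.getD_eq_getElem?_getD, List.getElem?_tail]

omit [NeZero N] in
/-- Tails of rows are rows. [folklore] -/
theorem isRow_tail {v : List ℕ} (hv : IsRow N (n + 1) v) : IsRow N n v.tail :=
  ⟨by rw [List.length_tail, hv.1]; rfl, fun x hx => hv.2 x (List.mem_of_mem_tail hx)⟩

/-- **The subgroup-order algorithm on residue rows** (`N ≠ 0`; rows of length `k`, entries `< N`).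
[cite: CheungMosca2001, §3] -/
def subgroupOrderRows (N : ℕ) : (k : ℕ) → List (List ℕ) → ℕ
  | 0, _ => 1
  | k + 1, rows =>
    match (elimFoldN N (k + 1) none [] rows).1 with
    | none => subgroupOrderRows N k ((elimFoldN N (k + 1) none [] rows).2.map List.tail)
    | some p => (ordVecN N p / ordVecN N (complementRowN N (k + 1) p)) *
        subgroupOrderRows N k ((complementRowN N (k + 1) p :: (elimFoldN N (k + 1) none [] rows).2).map List.tail)

/-- **`subgroupOrderRows` simulates `subgroupOrder`.** [folklore] -/
theorem subgroupOrderRows_eq : ∀ (k : ℕ) (rows : List (List ℕ)), (∀ v ∈ rows, IsRow N k v) →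
    subgroupOrderRows N k rows = subgroupOrder k (rows.map (toV N k))
  | 0, rows, _ => by rw [subgroupOrderRows, subgroupOrder]
  | k + 1, rows, hrows => by
    obtain ⟨e1, e2, e3, e4⟩ := elimFoldN_spec (N := N) (n := k) rows none [] hrows (fun p h => by cases h) (by simp)
    rw [Option.map_none, List.map_nil] at e1 e2
    rw [subgroupOrderRows, subgroupOrder, ← e1, ← e2]
    cases hpiv : (elimFoldN N (k + 1) none [] rows).1 with
    | none =>
      simp only [Option.map_none]
      rw [subgroupOrderRows_eq k _ (fun v hv => by
        obtain ⟨w, hw, rfl⟩ := List.mem_map.1 hv; exact isRow_tail (e4 w hw)), List.map_map, List.map_map]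
      congr 1
      exact List.map_congr_left fun v _ => toV_tail v
    | some p =>
      have hp : IsRow N (k + 1) p := e3 p hpiv
      simp only [Option.map_some]
      rw [ordVecN_eq hp, complementRowN, ordVecN_eq (isRow_zmulK _ _), ← complementRowN, toV_complementRowN hp,
        subgroupOrderRows_eq k _ (fun v hv => by
          obtain ⟨w, hw, rfl⟩ := List.mem_map.1 hv
          rcases List.mem_cons.1 hw with rfl | hw
          · exact isRow_tail (isRow_zmulK _ _)
          · exact isRow_tail (e4 w hw)), List.map_map, List.map_cons, List.map_cons, List.map_map]
      congr 2
      rw [Function.comp_apply, toV_tail, toV_complementRowN hp]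
      congr 1
      exact List.map_congr_left fun v _ => toV_tail v

/-- Normalising arbitrary natural rows: length `k`, entries reduced `mod N`. [folklore] -/
def normRow (N k : ℕ) (r : List ℕ) : List ℕ := (List.range k).map fun j => r.getD j 0 % N

/-- `normRow` is a row with the same vector. [folklore] -/
theorem normRow_spec (k : ℕ) (r : List ℕ) : IsRow N k (normRow N k r) ∧ toV N k (normRow N k r) = toV N k r := by
  refine ⟨⟨by simp [normRow], fun x hx => ?_⟩, funext fun j => ?_⟩
  · simp only [normRow, List.mem_map] at hx
    obtain ⟨j, -, rfl⟩ := hx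
    exact Nat.mod_lt _ (Nat.pos_of_ne_zero (NeZero.ne N))
  · rw [toV, normRow, getD_map_range j.isLt, ZMod.natCast_mod, toV]

/-- **The subgroup-order algorithm on arbitrary natural rows** (`0` for `N = 0`). [cite: CheungMosca2001, §3] -/
def subgroupOrderPure (N k : ℕ) (rows : List (List ℕ)) : ℕ :=
  if N = 0 then 0 else subgroupOrderRows N k (rows.map (normRow N k))

omit [NeZero N] in
/-- **`subgroupOrderNat` on list rows is `subgroupOrderPure`.** [folklore] -/
theorem subgroupOrderNat_getD_eq_pure (N k : ℕ) (rows : List (List ℕ)) :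
    subgroupOrderNat N k (rows.map fun r i => r.getD i 0) = subgroupOrderPure N k rows := by
  unfold subgroupOrderNat subgroupOrderPure
  by_cases hN : N = 0
  · rw [dif_pos hN, if_pos hN]
  · rw [dif_neg hN, if_neg hN]
    haveI : NeZero N := ⟨hN⟩
    rw [subgroupOrderRows_eq k _ (fun v hv => by
      obtain ⟨r, -, rfl⟩ := List.mem_map.1 hv; exact (normRow_spec k r).1), List.map_map, List.map_map]
    congr 1
    refine List.map_congr_left fun r _ => ?_
    have h2 := (normRow_spec (N := N) k r).2
    show _ = toV N k (normRow N k r)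
    rw [h2]
    rfl

end Howell

end Literature.Computability.Cryptography.Hallgren2005

end
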